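import Summits.ResolutionOfSingularities.ResolutionOfSingularities.Theorems.PurelyInseparableDim4ResConeChart
import HarnessLib
import HarnessLib.Audit.Tags

/-!
# Purely inseparable four-folds — the TAME CONE AT A CONSTANT-`d` STEP: the direction of a point
# blow-up that keeps the residual order lies in the vertex of the residual cone (idea-4 I-4-6 (VT)(i),
# Hironaka–Mizutani / [CJS 2020] Thm. 3.14 for the residual hypersurface, frame form), every prime, every `d`

[OURS · counted 0 · cell `res-dim4-pi` · desk WORDS #55 (a) / crit-4 g2 V-A4-13 (FILES 2–3 GO, price
P-A4-13a) · seat res-dim4-p-12 g2.]  Nothing here proves K2(p), `NoIsolatedTrap p p` or resolution of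
singularities in dimension ≥ 4 / characteristic `p`.

Setting (`…ResCone`, p664758): a presented state `s = (F, r, exc)` with `x^r ∣ F`, `ord₀ F = o` in the band
`p < o < 2p`, residual cone `g = resForm s` (degree `d = o − |r|` = the shade) and its polar kernel
`resVertex s` (⊇ the directrix/vertex of `V(g)`, `=` for `d < p`).  For the point step at the chart point
`b` of the `x_j`-chart (`b_j = 0`, direction `v = e_j + b`) the tree knows (p-9's `Straightening`) that the
cleaned transform is the chart-ORIGIN transform of the SHEARED polynomial `shear j b F`; the chart map at
the origin is injective on exponents (`x^e ↦ x^{e′}`, `e′_j = |e| − p`, `|e′| = 2|e| − p − e_j`) and, in the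
band, never produces a `p`-th power in degree `o` (`e′_j = o − p ∈ [1, p − 1]`) — bookkeeping in
`…ResConeChart` (FILE 2a).  Hence (§3) the monomial
of `shear j b (in F) = shear(x^r) · shear(g)` with the LARGEST `x_j`-exponent `A + k₀`
(`A = r_j + Σ_{lost} r_i`, `k₀ = degreeOf j (shear j b g)`) survives as a monomial of degree
`|r′| + d − k₀` of the new state, so

* **`shade_step_le` : (step).shade ≤ d − k₀** and `k₀ ≤ d` (§4) — a translated step LOWERS the residual
  order by at least the `x_j`-degree of the sheared residual cone;
* **`shear_resForm_free_of_shade_eq`**: if the residual order is kept (`(step).shade = s.shade`) then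
  `shear j b g` does not involve `x_j`, and by FILE 1's chain-rule lemma
  **`direction_mem_resVertex_of_shade_eq : direction j b ∈ resVertex s`** — (VT)(i): the near direction of a
  constant-`d` band step lies in the tame-cone vertex ([CJS 2020] Thm. 3.14 read on `V(g)`, rational points);
* **`shade_step_ne_of_resVertex_eq_bot`** — (VT)(iv): a state with `e_G = 0` (`resVertex s = ⊥`) has NO
  constant-`d` successor: every point step changes (lowers, by `…BandShade`) the residual order;
No characteristic hypothesis is used beyond `p < o < 2p` (no cleaning in the relevant degree).  FILE 3
((VT)(iii) `e_G` never rises, (E1-FREE), FT(p,p) assembly) follows.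
bears_on: LADDER-RESOLUTION:D157-DOOR2 (res-dim4-pi · K2(p) · I-4-6 (VT)(i)(iv)).  Supports
stmt-ResolutionOfSingularities-16155 (helper).
-/

set_option linter.dupNamespace false -- mandated namespace of this single-conjunct summit

noncomputable section

namespace Summit.ResolutionOfSingularities.ResolutionOfSingularities.Theorems.PIDim4

namespace ResCone

open MvPolynomial Finset
open Literature.AlgebraicGeometry.Resolution
open Literature.AlgebraicGeometry.Resolution.CentreBlowup
open Literature.AlgebraicGeometry.Resolution.Hauser2010
open Literature.AlgebraicGeometry.Resolution.HauserPerlega2019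
open PointBlowup (polarMap additiveSubspace direction)

variable {K : Type} [Field K]

/-! ## 3. The witnessing monomial of the new state -/

/-- The initial form of a non-zero polynomial is non-zero. [folklore] -/
theorem initialForm_ne_zero {F : MvPolynomial (Fin 4) K} {o : ℕ} (ho : ordZero F = o) : initialForm F ≠ 0 := by
  obtain ⟨⟨d, hd, hdeg⟩, -⟩ := (ordZero_eq_nat_iff F o).mp ho
  intro h
  have := congrArg (coeff d) h
  unfold initialForm at this
  rw [ho, ENat.toNat_coe, coeff_homogeneousComponent, if_pos hdeg, coeff_zero] at this
  exact hd this

/-- Monomials of `F − in F` have degree `> ord₀ F`. [folklore] -/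
theorem lt_degree_of_mem_support_sub_initialForm {F : MvPolynomial (Fin 4) K} {o : ℕ} (ho : ordZero F = o)
    {d : Fin 4 →₀ ℕ} (hd : d ∈ (F - initialForm F).support) : o < d.degree := by
  obtain ⟨-, hlow⟩ := (ordZero_eq_nat_iff F o).mp ho
  rw [MvPolynomial.mem_support_iff, coeff_sub] at hd
  unfold initialForm at hd
  rw [ho, ENat.toNat_coe, coeff_homogeneousComponent] at hd
  by_contra hle
  push Not at hle
  rcases hle.lt_or_eq with hlt | heq
  · rw [if_neg (by omega), sub_zero] at hd
    exact hd (hlow d hlt)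
  · rw [if_pos heq, sub_self] at hd
    exact hd rfl

/-- The shear of the initial form is homogeneous of degree `ord₀ F`. [folklore] -/
theorem isHomogeneous_shear_initialForm (j : Fin 4) (t : Fin 4 → K) {F : MvPolynomial (Fin 4) K} {o : ℕ}
    (ho : ordZero F = o) : (shear j t (initialForm F)).IsHomogeneous o := by
  classical
  rw [(initialForm F).as_sum]
  unfold shear
  rw [map_sum]
  refine MvPolynomial.IsHomogeneous.sum _ _ _ fun d hd => ?_
  have hdeg : d.degree = o := by
    have hhom : (initialForm F).IsHomogeneous o := by
      unfold initialForm; rw [ho]; exact homogeneousComponent_isHomogeneous o F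
    have := hhom (MvPolynomial.mem_support_iff.mp hd)
    rwa [weight_one_eq_degree] at this
  rw [← hdeg]
  exact Straightening.isHomogeneous_shear_monomial j t d _

/-- A monomial of `shear (in F)` is a monomial of `shear F` (the higher part of `F` shears into degrees
`> ord₀ F`). [folklore] -/
theorem coeff_shear_eq_coeff_shear_initialForm (j : Fin 4) (t : Fin 4 → K) {F : MvPolynomial (Fin 4) K}
    {o : ℕ} (ho : ordZero F = o) {e : Fin 4 →₀ ℕ} (he : e ∈ (shear j t (initialForm F)).support) :
    coeff e (shear j t F) = coeff e (shear j t (initialForm F)) := by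
  classical
  have hdeg : e.degree = o := by
    have := isHomogeneous_shear_initialForm j t ho (MvPolynomial.mem_support_iff.mp he)
    rwa [weight_one_eq_degree] at this
  have hsplit : shear j t F = shear j t (initialForm F) + shear j t (F - initialForm F) := by
    unfold shear; rw [← map_add, add_sub_cancel]
  rw [hsplit, coeff_add, add_eq_left]
  -- the higher part has order `≥ o + 1` along the point, before and after the shear
  have hord : ((o + 1 : ℕ) : ℕ∞) ≤ ordAlong Finset.univ (F - initialForm F) := by
    refine le_ordAlong_of_forall fun d hd => ?_
    rw [degIn_univ]
    exact lt_degree_of_mem_support_sub_initialForm ho hd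
  have hord' := Straightening.le_ordAlong_univ_shear j t hord
  by_contra hne
  have h := le_degree_of_mem_support hord' (MvPolynomial.mem_support_iff.mpr hne)
  omega

/-- **The witnessing monomial.** For `x^r ∣ F`, `ord₀ F = o` and `b_j = 0`: the sheared initial form
`shear j b (in F)` has a monomial `x^e`, `|e| = o`, with `x_j`-exponent EXACTLY
`e_j = (r_j + Σ_{b_i ≠ 0} r_i) + degreeOf j (shear j b (resForm s))`, and `x^e` is a monomial of
`shear j b F`. [folklore] -/
theorem exists_witness [DecidableEq K] (j : Fin 4) {b : Fin 4 → K} (hbj : b j = 0) {s : State K} {o : ℕ}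
    (ho : ordZero s.F = o) (hr : ∀ d ∈ s.F.support, s.r ≤ d) :
    ∃ e : Fin 4 →₀ ℕ, e ∈ (shear j b s.F).support ∧ e.degree = o ∧
      e j = ∑ i, s.r i * (if i = j ∨ b i ≠ 0 then 1 else 0) + degreeOf j (shear j b (resForm s)) := by
  classical
  set Φ := initialForm s.F with hΦ
  have hΦne : Φ ≠ 0 := initialForm_ne_zero ho
  have hg : resForm s ≠ 0 := by
    intro h
    apply hΦne
    rw [hΦ, ← monomial_mul_resForm hr, h, mul_zero]
  have hfact : shear j b Φ = shear j b (monomial s.r 1) * shear j b (resForm s) := by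
    rw [hΦ, ← monomial_mul_resForm hr]
    unfold shear
    rw [map_mul]
  have hdeg : degreeOf j (shear j b Φ) =
      ∑ i, s.r i * (if i = j ∨ b i ≠ 0 then 1 else 0) + degreeOf j (shear j b (resForm s)) := by
    rw [hfact, degreeOf_mul_eq (shear_ne_zero j hbj (monomial_eq_zero.not.mpr one_ne_zero))
      (shear_ne_zero j hbj hg), degreeOf_shear_monomial j hbj s.r one_ne_zero]
  -- a monomial attaining `degreeOf j`
  have hsupp : (shear j b Φ).support.Nonempty :=
    MvPolynomial.support_nonempty.mpr (shear_ne_zero j hbj hΦne)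
  obtain ⟨e, he, heq⟩ := Finset.exists_mem_eq_sup _ hsupp (fun m : Fin 4 →₀ ℕ => m j)
  have hej : e j = degreeOf j (shear j b Φ) := by rw [degreeOf_eq_sup]; exact heq.symm
  refine ⟨e, ?_, ?_, by rw [hej, hdeg]⟩
  · rw [MvPolynomial.mem_support_iff, coeff_shear_eq_coeff_shear_initialForm j b ho he]
    exact MvPolynomial.mem_support_iff.mp he
  · have := isHomogeneous_shear_initialForm j b ho (MvPolynomial.mem_support_iff.mp he)
    rwa [weight_one_eq_degree] at this

/-! ## 4. The shade after a point step: drop by the `x_j`-degree of the sheared residual cone -/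

/-- The polynomial of a point step is the cleaned chart-origin transform of the sheared polynomial
(p-9's shear conjugation). [cite: Hauser2010, §I (P⁺)] -/
theorem step_F_eq_deletePthPowers_chartTransform_shear [DecidableEq K] (q : ℕ) (j : Fin 4)
    {b : Fin 4 → K} (hbj : b j = 0) (s : State K) (hq : (q : ℕ∞) ≤ ordAlong Finset.univ s.F) :
    (CentreBlowup.step q Finset.univ j b s).F =
      deletePthPowers q (chartTransform q Finset.univ j (shear j b s.F)) := by
  rw [Straightening.step_F_eq_step_F_shear q j b hbj s hq 0 ∅]
  show deletePthPowers q (PointBlowup.translate (0 : Fin 4 → K)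
    (chartTransform q Finset.univ j (shear j b s.F))) = _
  rw [PointBlowup.translate_zero]

/-- Degree of the new boundary at a point step (`S = univ`): `|r′| = (o − q) + Σ_{i ≠ j, b_i = 0} r_i`.
[folklore] -/
theorem degree_step_r [DecidableEq K] (q : ℕ) (j : Fin 4) {b : Fin 4 → K} (hbj : b j = 0) (s : State K)
    {o : ℕ} (ho : ordZero s.F = o) (hr : ∀ d ∈ s.F.support, s.r ≤ d) :
    (CentreBlowup.step q Finset.univ j b s).r.degree + s.r j + ∑ i, s.r i * (if i = j ∨ b i ≠ 0 then 1 else 0)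
      = (o - q) + s.r.degree + s.r j := by
  classical
  have hro : s.r.degree ≤ o := by
    obtain ⟨⟨d₀, hd₀, hd₀deg⟩, -⟩ := (ordZero_eq_nat_iff _ _).mp ho
    exact hd₀deg ▸ PointBlowup.degree_le_degree_of_le (hr d₀ (MvPolynomial.mem_support_iff.mpr hd₀))
  have hperm : ∀ d ∈ s.F.support, degIn Finset.univ s.r + (o - s.r.degree) ≤ degIn Finset.univ d := by
    intro d hd
    rw [degIn_univ, degIn_univ]
    have h := Literature.Barriers.ResolutionOfSingularities.ordZero_le_of_coeff_ne_zero _ _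
      (MvPolynomial.mem_support_iff.mp hd)
    rw [ho] at h
    have : o ≤ d.degree := by exact_mod_cast h
    omega
  have hstep := step_r_eq q Finset.univ j b hbj s ho hr hperm
  rw [degIn_univ, show s.r.degree + (o - s.r.degree) - q = o - q by omega,
    PointBlowup.filter_update_of_pos s.r (Z := fun i => b i = 0) hbj] at hstep
  rw [hstep]
  have h1 := PointBlowup.degree_update_add (s.r.filter (fun i => b i = 0)) j (o - q)
  rw [Finsupp.filter_apply, if_pos hbj] at h1
  -- `|r.filter (b = 0)| + Σ_{translated} r_i = |r|`
  have h2 : (s.r.filter (fun i => b i = 0)).degree + ∑ i, s.r i * (if i = j ∨ b i ≠ 0 then 1 else 0) =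
      s.r.degree + s.r j := by
    rw [Finsupp.degree_eq_sum, Finsupp.degree_eq_sum, ← Finset.sum_add_distrib]
    rw [← Finset.add_sum_erase _ _ (Finset.mem_univ j), ← Finset.add_sum_erase _ (⇑s.r) (Finset.mem_univ j)]
    rw [Finsupp.filter_apply, if_pos hbj, if_pos (Or.inl rfl), mul_one]
    have : ∑ i ∈ Finset.univ.erase j, ((s.r.filter (fun i => b i = 0)) i + s.r i * (if i = j ∨ b i ≠ 0 then 1 else 0))
        = ∑ i ∈ Finset.univ.erase j, s.r i := by
      refine Finset.sum_congr rfl fun i hi => ?_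
      have hij : i ≠ j := Finset.ne_of_mem_erase hi
      rw [Finsupp.filter_apply]
      by_cases hbi : b i = 0
      · rw [if_pos hbi, if_neg (by tauto), mul_zero, add_zero]
      · rw [if_neg hbi, if_pos (Or.inr hbi), mul_one, zero_add]
    rw [this]
    ring
  omega

/-- The `x_j`-degree of the sheared residual cone does not exceed its degree `d`. [folklore] -/
theorem degreeOf_shear_resForm_le (j : Fin 4) (b : Fin 4 → K) {s : State K} {o : ℕ} (ho : ordZero s.F = o) :
    degreeOf j (shear j b (resForm s)) ≤ o - s.r.degree := by
  classical
  rw [degreeOf_le_iff]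
  intro m hm
  have hhom : (shear j b (resForm s)).IsHomogeneous (o - s.r.degree) := by
    rw [(resForm s).as_sum]
    unfold shear
    rw [map_sum]
    refine MvPolynomial.IsHomogeneous.sum _ _ _ fun d hd => ?_
    have hdeg : d.degree = o - s.r.degree := by
      have := resForm_isHomogeneous ho (MvPolynomial.mem_support_iff.mp hd)
      rwa [weight_one_eq_degree] at this
    rw [← hdeg]
    exact Straightening.isHomogeneous_shear_monomial j b d _
  have hdeg := hhom (MvPolynomial.mem_support_iff.mp hm)
  rw [weight_one_eq_degree] at hdeg
  rw [← hdeg, Finsupp.degree_eq_sum]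
  exact Finset.single_le_sum (fun i _ => Nat.zero_le _) (Finset.mem_univ j)

/-- **THE SHADE AFTER A POINT STEP IN THE BAND.**  For `x^r ∣ F`, `ord₀ F = o` with `q < o < 2q`, and a chart
point `b` of the `x_j`-chart (`b_j = 0`): the shade of the new state is at most
`d − degreeOf j (shear j b g)`, `d = o − |r|` the shade of `s`, `g` its residual cone — the largest
`x_j`-power of the sheared cone is paid out of the residual order. (Proof: the witnessing monomial of §3
maps to a monomial of degree `|r′| + d − k₀` of the transform whose `x_j`-exponent `o − q ∈ [1, q−1]` is
prime to `q`, so cleaning keeps it.) [OURS] [folklore] -/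
theorem shade_step_le [DecidableEq K] {q : ℕ} (j : Fin 4) {b : Fin 4 → K} (hbj : b j = 0) {s : State K}
    {o : ℕ} (ho : ordZero s.F = o) (hr : ∀ d ∈ s.F.support, s.r ≤ d) (hqo : q < o) (ho2 : o < 2 * q) :
    (CentreBlowup.step q Finset.univ j b s).shade ≤
      ((o - s.r.degree - degreeOf j (shear j b (resForm s)) : ℕ) : ℕ∞) := by
  classical
  set k₀ := degreeOf j (shear j b (resForm s)) with hk₀
  set A := ∑ i, s.r i * (if i = j ∨ b i ≠ 0 then 1 else 0) with hA
  have hq : (q : ℕ∞) ≤ ordAlong Finset.univ s.F := by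
    rw [ordAlong_univ, ho]; exact_mod_cast hqo.le
  have hq' := Straightening.le_ordAlong_univ_shear j b hq
  -- the witnessing monomial and its image
  obtain ⟨e, he, hedeg, hej⟩ := exists_witness j hbj ho hr
  set E := chartExponent q Finset.univ j e with hE
  have hcoeff : coeff E (CentreBlowup.step q Finset.univ j b s).F ≠ 0 := by
    rw [step_F_eq_deletePthPowers_chartTransform_shear q j hbj s hq, coeff_deletePthPowers, if_neg,
      coeff_chartTransform_chartExponent hq' he]
    · exact MvPolynomial.mem_support_iff.mp he
    · -- `E_j = o − q` is not a multiple of `q`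
      intro hP
      have hEj : E j = o - q := by rw [hE, chartExponent_univ_apply_self, hedeg]
      have hdvd : q ∣ E j := hP j (Finsupp.mem_support_iff.mpr (by rw [hEj]; omega))
      rw [hEj] at hdvd
      obtain ⟨c, hc⟩ := hdvd
      rcases Nat.lt_or_ge c 1 with hc1 | hc1
      · interval_cases c; omega
      · have : q * 1 ≤ q * c := Nat.mul_le_mul_left q hc1
        omega
  -- hence `ord₀ F′ ≤ |E|`
  have hord : ordZero (CentreBlowup.step q Finset.univ j b s).F ≤ (E.degree : ℕ∞) :=
    Literature.Barriers.ResolutionOfSingularities.ordZero_le_of_coeff_ne_zero _ _ hcoeff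
  have hEdeg := degree_chartExponent_univ q j (e := e) (by rw [hedeg]; exact hqo.le)
  have hrdeg := degree_step_r q j hbj s ho hr
  have hk₀d := degreeOf_shear_resForm_le j b ho (s := s)
  have hro : s.r.degree ≤ o := by
    obtain ⟨⟨d₀, hd₀, hd₀deg⟩, -⟩ := (ordZero_eq_nat_iff _ _).mp ho
    exact hd₀deg ▸ PointBlowup.degree_le_degree_of_le (hr d₀ (MvPolynomial.mem_support_iff.mpr hd₀))
  have hrj : s.r j ≤ s.r.degree := by
    rw [Finsupp.degree_eq_sum]; exact Finset.single_le_sum (fun i _ => Nat.zero_le _) (Finset.mem_univ j)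
  -- shade = ord − |r′|
  unfold CState.shade
  have hbound : E.degree ≤ (CentreBlowup.step q Finset.univ j b s).r.degree + (o - s.r.degree - k₀) := by
    rw [← hE, hedeg, hej, ← hA, ← hk₀] at hEdeg
    omega
  calc ordZero (CentreBlowup.step q Finset.univ j b s).F - ((CentreBlowup.step q Finset.univ j b s).r.degree : ℕ∞)
      ≤ (E.degree : ℕ∞) - ((CentreBlowup.step q Finset.univ j b s).r.degree : ℕ∞) := tsub_le_tsub_right hord _
    _ ≤ ((o - s.r.degree - k₀ : ℕ) : ℕ∞) := by
        rw [← ENat.coe_sub]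
        exact_mod_cast Nat.sub_le_of_le_add (by rwa [Nat.add_comm] at hbound)

/-- **Constant residual order ⇒ the sheared residual cone is `x_j`-free.** [OURS] [folklore] -/
theorem shear_resForm_free_of_shade_eq [DecidableEq K] {q : ℕ} (j : Fin 4) {b : Fin 4 → K} (hbj : b j = 0)
    {s : State K} {o : ℕ} (ho : ordZero s.F = o) (hr : ∀ d ∈ s.F.support, s.r ≤ d) (hqo : q < o)
    (ho2 : o < 2 * q) (heq : (CentreBlowup.step q Finset.univ j b s).shade = s.shade) :
    ∀ e ∈ (shear j b (resForm s)).support, e j = 0 := by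
  have h := shade_step_le j hbj ho hr hqo ho2
  rw [heq, BandShade.shade_eq_coe ho] at h
  have hk := degreeOf_shear_resForm_le j b ho (s := s)
  have h' : o - s.r.degree ≤ o - s.r.degree - degreeOf j (shear j b (resForm s)) := by exact_mod_cast h
  have hk0 : degreeOf j (shear j b (resForm s)) = 0 := by omega
  intro e he
  have := monomial_le_degreeOf j he
  omega

/-- **(VT)(i) — THE NEAR DIRECTION OF A CONSTANT-`d` BAND STEP LIES IN THE TAME-CONE VERTEX**
(idea-4 CARD I-4-6 (VT)(i); Hironaka–Mizutani / [CJS 2020] Thm. 3.14 for the residual hypersurface `V(g)`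
at a rational point, frame form, every exponent `q` and every residual degree): if `x^r ∣ F`,
`q < ord₀ F < 2q`, `b_j = 0` and the point step at `b` keeps the shade, then `direction j b ∈ resVertex s`.
[OURS] [cite: CossartJannsenSaito2020, Thm. 3.14] -/
theorem direction_mem_resVertex_of_shade_eq [DecidableEq K] {q : ℕ} (j : Fin 4) {b : Fin 4 → K}
    (hbj : b j = 0) {s : State K} {o : ℕ} (ho : ordZero s.F = o) (hr : ∀ d ∈ s.F.support, s.r ≤ d)
    (hqo : q < o) (ho2 : o < 2 * q) (heq : (CentreBlowup.step q Finset.univ j b s).shade = s.shade) :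
    direction j b ∈ resVertex s :=
  direction_mem_additiveSubspace_of_shear_free j hbj (shear_resForm_free_of_shade_eq j hbj ho hr hqo ho2 heq)

/-- **(VT)(iv) — `e_G = 0` states have no constant-`d` successor**: if the tame-cone vertex is trivial,
every point step in the band strictly lowers the residual order. [OURS] [cite: CossartJannsenSaito2020, Thm. 3.14] -/
theorem shade_step_ne_of_resVertex_eq_bot [DecidableEq K] {q : ℕ} (j : Fin 4) {b : Fin 4 → K}
    (hbj : b j = 0) {s : State K} {o : ℕ} (ho : ordZero s.F = o) (hr : ∀ d ∈ s.F.support, s.r ≤ d)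
    (hqo : q < o) (ho2 : o < 2 * q) (hbot : resVertex s = ⊥) :
    (CentreBlowup.step q Finset.univ j b s).shade ≠ s.shade := by
  intro heq
  have h := direction_mem_resVertex_of_shade_eq j hbj ho hr hqo ho2 heq
  rw [hbot, Submodule.mem_bot] at h
  have := congrFun h j
  unfold direction at this
  rw [Function.update_self] at this
  exact one_ne_zero this

end ResCone

end Summit.ResolutionOfSingularities.ResolutionOfSingularities.Theorems.PIDim4

end
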